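import Mathlib
import Summits.ValiantsHypothesis.ValiantsHypothesis.Theses.ValuativeGCT
import Literature.NumberTheory.DiophantineGeometry.GLHighestWeightFacts
import Literature.Computability.AlgebraicComplexity.OrbitClosureWeights
import Literature.Computability.Complexity.OccurrenceObstructionsIP
import Summits.ValiantsHypothesis.ValiantsHypothesis.Theorems.ValuativeGCTCutBitesHwExtraction

/-!
# Semi-invariants of a four-row weight are functions of the four kept rows (det side of the bridge)

Det-side input for stub `stub_fourRowBridge` of line `four-row-count` for crux
`ValuativeGCT.ValuativeFlip` (stmt-ValiantsHypothesis-12624).  `W = ℂ^{m×m}`,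
`R = ℂ[End W] = MvPolynomial (MatIdx m × MatIdx m) ℂ` (variables `X (j, i)`, row slot `j`, matrix
position `i`); the crux's Borel clause is semi-invariance under the LEFT translation
`X (j, i) ↦ ∑ l, (g⁻¹) j l • X (l, i)` with character `weightChar λ*`, `λ* = (dualOfPartition (m·m) λ).toMatIdx`.

`fourRow_hwsp_le_supported`: if `λ` has at most four parts, every such semi-invariant is supported
on the variables of the KEPT row slots `j` (`m·m ≤ idx(j) + 4`, the last four slots of the
lexicographic enumeration).  Reason: a semi-invariant is a torus weight vector, the torus weight of
a monomial is minus its vector of row degrees (`hwx_weight_eq_neg_rowDegrees`, landed with CutBites),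
and `λ*` vanishes at every slot of index `< m·m - 4` when `ℓ(λ) ≤ 4`
(`dualOfPartition (m·m) λ (idx) = -λ_{m·m - idx}`).  Hence the det-side multiplicity space
`Hom ⊓ SAND ⊓ HWSP(λ*)` of the crux lies inside the four-row module `Hom ⊓ SAND ⊓ ROWS₄` bounded by
`stub_fourRowSliceBound` (`fourRow_detMult_le_fourRow`).  Elementary; no named facts.
-/

-- `Summit.ValiantsHypothesis.ValiantsHypothesis.…` is the tree's mandated single-conjunct layout (Sub = Summit).
set_option linter.dupNamespace false

namespace Summit.ValiantsHypothesis.ValiantsHypothesis.Theorems.ValuativeFlip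

open MvPolynomial
open scoped BigOperators Matrix
open Literature.NumberTheory.DiophantineGeometry
open Literature.Computability.AlgebraicComplexity
open Summit.ValiantsHypothesis.ValiantsHypothesis.Theorems.CutBitesAdjugate

noncomputable section

/-- The dual weight `λ*` of a partition with at most `L` parts vanishes at every index `i` with
`i + L < N` (only the last `L` entries `-λ_L, …, -λ₁` can be nonzero). [folklore] -/
theorem dualOfPartition_apply_eq_zero_of_card_le {N d L : ℕ} (lam : Nat.Partition d)
    (hL : lam.parts.card ≤ L) (i : Fin N) (hi : (i : ℕ) + L < N) :
    Weight.dualOfPartition N lam i = 0 := by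
  rw [Weight.dualOfPartition, Weight.dual, Weight.ofPartition_apply, neg_eq_zero, Nat.cast_eq_zero]
  apply Literature.Computability.Complexity.getD_sortedParts_eq_zero lam
  rw [Fin.val_rev]
  omega

/-- The transported dual weight `(λ*).toMatIdx` of a partition with at most four parts vanishes
at every row slot that is NOT kept (`idx(j) + 4 < m·m`). [folklore] -/
theorem toMatIdx_dualOfPartition_eq_zero_of_not_kept {m d : ℕ} (lam : Nat.Partition d)
    (hlam : lam.parts.card ≤ 4) (j : MatIdx m)
    (hj : ¬ m * m ≤ (((matIdxEquiv m).symm j : Fin (m * m)) : ℕ) + 4) :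
    ((Weight.dualOfPartition (m * m) lam).toMatIdx : Weight (MatIdx m)) j = 0 :=
  dualOfPartition_apply_eq_zero_of_card_le lam hlam _ (by omega)

/-- **Semi-invariants of a `≤ 4`-row weight live on the four kept rows.**  If `λ` has at most four
parts, every `B`-semi-invariant of weight `λ* = (dualOfPartition (m·m) λ).toMatIdx` for the left
translation `X (j,i) ↦ ∑ l, (g⁻¹) j l • X (l,i)` (the crux's Borel clause) is supported on the
variables `X (j, i)` with `m·m ≤ idx(j) + 4`: its torus weight `λ*` is minus the row-degree vector
of each of its monomials (`hwx_weight_eq_neg_rowDegrees`), and `λ*` vanishes off the kept slots.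
[folklore; BLMW 2011 §5.2 (weights of coordinate rings)] -/
theorem fourRow_hwsp_le_supported (m : ℕ) {d : ℕ} (lam : Nat.Partition d) (hlam : lam.parts.card ≤ 4) :
    (⨅ (g : Matrix.GeneralLinearGroup (MatIdx m) ℂ) (_ : IsUpperTriangular g),
        LinearMap.ker ((MvPolynomial.aeval fun p : MatIdx m × MatIdx m =>
            ∑ l : MatIdx m, ((g⁻¹ : Matrix.GeneralLinearGroup (MatIdx m) ℂ) : Matrix (MatIdx m) (MatIdx m) ℂ) p.1 l •
              (MvPolynomial.X (l, p.2) : MvPolynomial (MatIdx m × MatIdx m) ℂ)).toLinearMap -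
          weightChar ((Weight.dualOfPartition (m * m) lam).toMatIdx : Weight (MatIdx m)) g •
            (LinearMap.id : MvPolynomial (MatIdx m × MatIdx m) ℂ →ₗ[ℂ] MvPolynomial (MatIdx m × MatIdx m) ℂ))) ≤
      Subalgebra.toSubmodule (MvPolynomial.supported ℂ
        {p : MatIdx m × MatIdx m | m * m ≤ (((matIdxEquiv m).symm p.1 : Fin (m * m)) : ℕ) + 4}) := by
  classical
  intro G hG
  set χ : Weight (MatIdx m) := (Weight.dualOfPartition (m * m) lam).toMatIdx with hχ
  have hw : ∀ t : GL (MatIdx m) ℂ, IsDiagonalGL t →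
      MvPolynomial.aeval (R := ℂ) (fun p : MatIdx m × MatIdx m =>
        ∑ l : MatIdx m, ((t⁻¹ : GL (MatIdx m) ℂ) : Matrix (MatIdx m) (MatIdx m) ℂ) p.1 l •
          (X (l, p.2) : MvPolynomial (MatIdx m × MatIdx m) ℂ)) G = weightChar χ t • G := by
    intro t ht
    have h1 := (Submodule.mem_iInf _).mp hG t
    have h2 := (Submodule.mem_iInf _).mp h1 ht.isUpperTriangular
    rw [LinearMap.mem_ker, LinearMap.sub_apply, sub_eq_zero] at h2
    exact h2
  change G ∈ MvPolynomial.supported ℂ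
    {p : MatIdx m × MatIdx m | m * m ≤ (((matIdxEquiv m).symm p.1 : Fin (m * m)) : ℕ) + 4}
  rw [mem_supported]
  intro p hp
  obtain ⟨s, hs, hps⟩ := (mem_vars_iff_mem_support p).mp (Finset.mem_coe.mp hp)
  have hcoeff : coeff s G ≠ 0 := mem_support_iff.mp hs
  have hχs := hwx_weight_eq_neg_rowDegrees hw hcoeff
  have h1 : χ p.1 = -((∑ q ∈ s.support with q.1 = p.1, s q : ℕ) : ℤ) := congrFun hχs p.1
  have hpos : 0 < ∑ q ∈ s.support with q.1 = p.1, s q := by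
    have hle : s p ≤ ∑ q ∈ s.support with q.1 = p.1, s q :=
      Finset.single_le_sum (f := fun q => s q) (fun _ _ => Nat.zero_le _)
        (Finset.mem_filter.mpr ⟨hps, rfl⟩)
    exact lt_of_lt_of_le (Nat.pos_of_ne_zero (Finsupp.mem_support_iff.mp hps)) hle
  by_contra hk
  have h0 : χ p.1 = 0 := toMatIdx_dualOfPartition_eq_zero_of_not_kept lam hlam p.1 hk
  rw [h0] at h1
  omega

/-- **Det-side multiplicity space of a four-row shape sits in the four-row module.**  For `λ` with
at most four parts, the crux's det-side space `Hom_D ⊓ SAND ⊓ HWSP(λ*)` (degree-`D` row-wise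
unimodular sandwich invariants that are `B`-semi-invariants of weight `λ*`) is contained in
`Hom_D ⊓ SAND ⊓ ROWS₄` (the same invariants among functions of the four kept rows), the module
bounded by `stub_fourRowSliceBound`. [folklore; BLMW 2011 §5.2] -/
theorem fourRow_detMult_le_fourRow (m D : ℕ) {d : ℕ} (lam : Nat.Partition d) (hlam : lam.parts.card ≤ 4) :
    MvPolynomial.homogeneousSubmodule (MatIdx m × MatIdx m) ℂ D ⊓
        (⨅ (P : Matrix (Fin m) (Fin m) ℂ) (Q : Matrix (Fin m) (Fin m) ℂ) (_ : P.det = 1) (_ : Q.det = 1),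
          LinearMap.ker ((MvPolynomial.aeval fun p : MatIdx m × MatIdx m =>
              ∑ l : MatIdx m, (P (ofLex p.2).1 (ofLex l).1 * Q (ofLex l).2 (ofLex p.2).2) •
                (MvPolynomial.X (p.1, l) : MvPolynomial (MatIdx m × MatIdx m) ℂ)).toLinearMap -
            (LinearMap.id : MvPolynomial (MatIdx m × MatIdx m) ℂ →ₗ[ℂ] MvPolynomial (MatIdx m × MatIdx m) ℂ))) ⊓
        (⨅ (g : Matrix.GeneralLinearGroup (MatIdx m) ℂ) (_ : IsUpperTriangular g),
          LinearMap.ker ((MvPolynomial.aeval fun p : MatIdx m × MatIdx m =>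
              ∑ l : MatIdx m, ((g⁻¹ : Matrix.GeneralLinearGroup (MatIdx m) ℂ) : Matrix (MatIdx m) (MatIdx m) ℂ) p.1 l •
                (MvPolynomial.X (l, p.2) : MvPolynomial (MatIdx m × MatIdx m) ℂ)).toLinearMap -
            weightChar ((Weight.dualOfPartition (m * m) lam).toMatIdx : Weight (MatIdx m)) g •
              (LinearMap.id : MvPolynomial (MatIdx m × MatIdx m) ℂ →ₗ[ℂ] MvPolynomial (MatIdx m × MatIdx m) ℂ))) ≤
      MvPolynomial.homogeneousSubmodule (MatIdx m × MatIdx m) ℂ D ⊓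
        (⨅ (P : Matrix (Fin m) (Fin m) ℂ) (Q : Matrix (Fin m) (Fin m) ℂ) (_ : P.det = 1) (_ : Q.det = 1),
          LinearMap.ker ((MvPolynomial.aeval fun p : MatIdx m × MatIdx m =>
              ∑ l : MatIdx m, (P (ofLex p.2).1 (ofLex l).1 * Q (ofLex l).2 (ofLex p.2).2) •
                (MvPolynomial.X (p.1, l) : MvPolynomial (MatIdx m × MatIdx m) ℂ)).toLinearMap -
            (LinearMap.id : MvPolynomial (MatIdx m × MatIdx m) ℂ →ₗ[ℂ] MvPolynomial (MatIdx m × MatIdx m) ℂ))) ⊓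
        Subalgebra.toSubmodule (MvPolynomial.supported ℂ
          {p : MatIdx m × MatIdx m | m * m ≤ (((matIdxEquiv m).symm p.1 : Fin (m * m)) : ℕ) + 4}) :=
  inf_le_inf le_rfl (fourRow_hwsp_le_supported m lam hlam)

end

end Summit.ValiantsHypothesis.ValiantsHypothesis.Theorems.ValuativeFlip
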